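import Literature.NumberTheory.Automorphic.CuspFormCornerDecay
import Literature.NumberTheory.Automorphic.AdeleQuotientFourier
import HarnessLib

/-!
# Reduction theory for `SL₂` over a number field: `SL₂(𝔸_K) = SL₂(K) · A_{T₀}(t) · C`, `C` compact

Topic `NumberTheory/Automorphic`; namespace `Literature.NumberTheory.Automorphic` (grouping sub-namespace `SL2Reduction`).
KERNEL only: proved theorems, no definition, no named fact, no `sorry`.

From the tree's reduction theory for `GL_n` over a number field `K` (★ `reductionTheory_gl_holds`, `MinkowskiReductionGLn`;
Getz–Hahn (2024), Thm. 2.7.2, `GL_n(𝔸_K) = GL_n(K) · A_G · Ω A_{T₀}(t) K`, in the corner shape ★ `exists_reduction_corner_shape`: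
`h = γ · z(τ) · diag(b) · y`, `y` in a compact `Y`, `|det h|_𝔸 = τ^{n[K:ℚ]}`) we derive the classical reduction of the
DETERMINANT-ONE subgroup at `n = 2`:

* `SL2Reduction.exists_reduction` — **there are `t > 0` and a COMPACT `C ⊆ {c ∈ GL₂(𝔸_K) : det c = 1}` such that every
  `g ∈ GL₂(𝔸_K)` with `det g = 1` is `g = γ · a · c` with `γ ∈ GL₂(K)` rational OF DETERMINANT `1`, `a ∈ A_{T₀}(t)` (the
  Siegel cone `siegelCone 2 K t`: archimedean positive real `diag(b₁, b₂)`, `b₁ b₂ = 1`, `b₁ ≥ t b₂`) and `c ∈ C`** — i.e.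
  `SL₂(𝔸_K) = SL₂(K) · A_{T₀}(t) · C` ([Borel1963, §5 Thm. 5.8 and §7]; [GetzHahn2024, Thm. 2.7.2]; for `SL₂∕ℚ` the classical
  Siegel domain of [Gelbart1975, §9.B]).

THE PROOF (determinant bookkeeping on top of ★ `exists_reduction_corner_shape 2 K`): for `det g = 1` the split-centre
coordinate is `τ = 1` (`|det z(τ)|_𝔸 = τ^{2[K:ℚ]}`, `posRealScalar_eq_one_of_glAbsDet_eq_one`), so `g = γ · diag(b) · y`; the
rational determinant `d := det γ ∈ Kˣ` has its principal idele in the compact `(det Y)⁻¹`, hence lies in a FINITE set `D` (`K` is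
discrete in `𝔸_K`: `finite_setOf_algebraMap_units_mem`); the rational diagonal correction `δ_d = diag(d, 1)` COMMUTES with the
diagonal `diag(b)`, so `g = (γ δ_d⁻¹) · diag(b) · (δ_d y)` with `γ δ_d⁻¹` rational of determinant one and `δ_d y` in the compact
`⋃_{d ∈ D} δ_d · Y`, cut down to `{det = 1}` (closed).

Written for the Hodge-CM cell `pub/hodgecm-mathlib`, floor 0, E-2 child line `F0_E2SiegelWeilWeilRange` of crux H413
(stmt-HodgeConjecture-24833): row SW2c-RED (reduction theory for the rank-one doubled unitary group `U(W ⊕ W⁻) ⊇ SU ≅ SL₂`,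
Weil's Lemma 20 in the proof of the Siegel formula, [Weil1965, n° 49]) — this file is its `SL₂` half; the transport to
`U(τ, J₁)(𝔸_F)` through ★ `DoubledUnitaryRankOneSL2Model` is the sequel.  HC_CM is proved only modulo the printed citations
until rung 0 closes; this file discharges none of them.

## References
* [GetzHahn2024] J. R. Getz, H. Hahn, *An Introduction to Automorphic Representations* (2024), §2.7, Thm. 2.7.2 (printed p. 48).
* [Borel1963] A. Borel, *Some finiteness properties of adele groups over number fields*, Publ. Math. IHÉS 16 (1963), §5
  (Thm. 5.8) and §7 (semisimple groups).
* [Gelbart1975] S. Gelbart, *Automorphic forms on adele groups*, Ann. of Math. Studies 83 (1975), §9.B (the Siegel domain).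
* [Weil1965] A. Weil, Acta Math. 113 (1965) 1–87, n° 49 Lemma 20 (reduction theory in the proof of the Siegel formula).
* [CasselsFrohlichANT1967] J. W. S. Cassels, A. Fröhlich (eds.), *Algebraic Number Theory* (1967), Ch. II §14 (`K` discrete in `𝔸_K`).
-/

set_option autoImplicit false

noncomputable section

open NumberField IsDedekindDomain Matrix Set
open scoped MatrixGroups NNReal Pointwise

namespace Literature.NumberTheory.Automorphic

namespace SL2Reduction

variable {n : ℕ} (K : Type) [Field K] [NumberField K]

/-! ## §1 Three small inputs: `z(r) = 1` from `|det| = 1`; finiteness of rational points in a compact; rational diagonals -/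

/-- **`z(r) = 1` as soon as `|det z(r)|_𝔸 = 1`** (`|det z(r)|_𝔸 = r^{n[K:ℚ]}` and `n [K:ℚ] ≠ 0` for `n ≥ 1`).
[cite: Borel1963, §5] -/
theorem posRealScalar_eq_one_of_glAbsDet_eq_one (hn : n ≠ 0) {r : ℝ≥0ˣ}
    (h : glAbsDet n K (posRealScalar n K r) = 1) : posRealScalar n K r = 1 := by
  rw [glAbsDet_posRealScalar] at h
  have hN : n * Module.finrank ℚ K ≠ 0 := Nat.mul_ne_zero hn Module.finrank_pos.ne'
  have hr : r = 1 := by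
    have h' : ((r : ℝ≥0) : ℝ) ^ (n * Module.finrank ℚ K) = 1 := by
      have := congrArg (fun x : ℝ≥0ˣ => ((x : ℝ≥0) : ℝ)) h
      simpa using this
    have hr0 : (0 : ℝ) ≤ ((r : ℝ≥0) : ℝ) := NNReal.coe_nonneg _
    have : ((r : ℝ≥0) : ℝ) = 1 := (pow_eq_one_iff_of_nonneg hr0 hN).1 h'
    exact Units.ext (NNReal.coe_injective (by simpa using this))
  rw [hr, map_one]

/-- **`{ξ ∈ Kˣ : ι(ξ) ∈ E}` is finite for compact `E ⊆ 𝔸_K`** (`K` is a discrete, hence closed, subgroup of the Hausdorff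
group `𝔸_K`, so `K ∩ E` is compact and discrete). [cite: CasselsFrohlichANT1967, Ch. II §14 Theorem] -/
theorem finite_setOf_algebraMap_units_mem {E : Set (AdeleRing (𝓞 K) K)} (hE : IsCompact E) :
    Set.Finite {ξ : Kˣ | algebraMap K (AdeleRing (𝓞 K) K) ξ ∈ E} := by
  haveI := t2Space_adeleRing K
  haveI := AdeleRing.discreteTopology_principalSubgroup K
  have hc : IsCompact (Subtype.val ⁻¹' E : Set ↥(AdeleRing.principalSubgroup (𝓞 K) K)) :=
    (isClosed_principalSubgroup K).isClosedEmbedding_subtypeVal.isCompact_preimage hE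
  have hfin : (Subtype.val ⁻¹' E : Set ↥(AdeleRing.principalSubgroup (𝓞 K) K)).Finite :=
    hc.finite_of_discrete
  let f : Kˣ → ↥(AdeleRing.principalSubgroup (𝓞 K) K) := fun ξ =>
    ⟨algebraMap K (AdeleRing (𝓞 K) K) ξ, ⟨ξ, rfl⟩⟩
  have hf : Function.Injective f := fun ξ η h =>
    Units.ext (NumberField.AdeleRing.algebraMap_injective (𝓞 K) K (congrArg Subtype.val h))
  have heq : {ξ : Kˣ | algebraMap K (AdeleRing (𝓞 K) K) ξ ∈ E} = f ⁻¹' (Subtype.val ⁻¹' E) := by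
    ext ξ; rfl
  rw [heq]
  exact hfin.preimage hf.injOn

/-- `GL_n(f)` maps `glDiagonal d` to `glDiagonal (f ∘ d)`. [folklore] -/
private theorem map_glDiagonal {R S : Type*} [CommRing R] [CommRing S] (f : R →+* S) (d : Fin n → Rˣ) :
    Matrix.GeneralLinearGroup.map f (glDiagonal n R d) = glDiagonal n S fun i => Units.map (f : R →* S) (d i) := by
  refine Matrix.GeneralLinearGroup.ext fun i j => ?_
  change f ((glDiagonal n R d : Matrix (Fin n) (Fin n) R) i j) = _
  rw [coe_glDiagonal, coe_glDiagonal, Matrix.diagonal_apply, Matrix.diagonal_apply]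
  split_ifs <;> simp

/-- The rational diagonal correction `δ_d = diag(ι d, 1) ∈ GL₂(𝔸_K)` (`d ∈ Kˣ`): it is RATIONAL and `det δ_d = ι d`.
[folklore] -/
private theorem diagCorrection_spec (d : Kˣ) :
    glDiagonal 2 (AdeleRing (𝓞 K) K) ![Units.map (algebraMap K (AdeleRing (𝓞 K) K) : K →* AdeleRing (𝓞 K) K) d, 1] ∈
        rationalPointsGL 2 K ∧
      Matrix.GeneralLinearGroup.det
        (glDiagonal 2 (AdeleRing (𝓞 K) K) ![Units.map (algebraMap K (AdeleRing (𝓞 K) K) : K →* AdeleRing (𝓞 K) K) d, 1]) =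
          Units.map (algebraMap K (AdeleRing (𝓞 K) K) : K →* AdeleRing (𝓞 K) K) d := by
  refine ⟨⟨glDiagonal 2 K ![d, 1], ?_⟩, ?_⟩
  · rw [map_glDiagonal]
    congr 1
    funext i
    fin_cases i <;> simp
  · refine Units.ext ?_
    rw [Matrix.GeneralLinearGroup.val_det_apply, coe_glDiagonal, Matrix.det_diagonal, Fin.prod_univ_two]
    simp

/-! ## §2 The reduction theorem for `SL₂(𝔸_K)` -/

/-- **Reduction theory for `SL₂` over the number field `K`** — `SL₂(𝔸_K) = SL₂(K) · A_{T₀}(t) · C` with `C` compact: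
there are `t > 0` and a compact `C ⊆ GL₂(𝔸_K)` consisting of elements of determinant `1` such that every `g` with
`det g = 1` is `γ · a · c` with `γ ∈ GL₂(K)` (`rationalPointsGL`) of determinant `1`, `a` in the Siegel cone
`A_{T₀}(t)` (`siegelCone 2 K t`) and `c ∈ C`.  From ★ `exists_reduction_corner_shape 2 K` by the determinant bookkeeping of the
module docstring. [cite: Borel1963, §5 Thm. 5.8 and §7] -/
theorem exists_reduction :
    ∃ t : ℝ, 0 < t ∧ ∃ C : Set (GL (Fin 2) (AdeleRing (𝓞 K) K)), IsCompact C ∧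
      (∀ c ∈ C, Matrix.GeneralLinearGroup.det c = 1) ∧
      ∀ g : GL (Fin 2) (AdeleRing (𝓞 K) K), Matrix.GeneralLinearGroup.det g = 1 →
        ∃ γ ∈ rationalPointsGL 2 K, Matrix.GeneralLinearGroup.det γ = 1 ∧
          ∃ a ∈ siegelCone 2 K t, ∃ c ∈ C, γ * a * c = g := by
  obtain ⟨t, Y, ht, -, hYc, hdec⟩ := exists_reduction_corner_shape 2 K
  -- the finite set of rational determinant corrections
  set E : Set (AdeleRing (𝓞 K) K) := Units.val '' ((fun u : (AdeleRing (𝓞 K) K)ˣ => u⁻¹) ''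
    (Matrix.GeneralLinearGroup.det '' Y)) with hE
  have hEc : IsCompact E :=
    ((hYc.image Matrix.GeneralLinearGroup.continuous_det).image continuous_inv).image Units.continuous_val
  have hDfin : Set.Finite {ξ : Kˣ | algebraMap K (AdeleRing (𝓞 K) K) ξ ∈ E} :=
    finite_setOf_algebraMap_units_mem K hEc
  -- the rational diagonal corrections `δ_d`
  let δ : Kˣ → GL (Fin 2) (AdeleRing (𝓞 K) K) := fun d =>
    glDiagonal 2 (AdeleRing (𝓞 K) K) ![Units.map (algebraMap K (AdeleRing (𝓞 K) K) : K →* AdeleRing (𝓞 K) K) d, 1]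
  have hδ : ∀ d, δ d ∈ rationalPointsGL 2 K ∧
      Matrix.GeneralLinearGroup.det (δ d) = Units.map (algebraMap K (AdeleRing (𝓞 K) K) : K →* AdeleRing (𝓞 K) K) d :=
    fun d => diagCorrection_spec K d
  -- `δ_d` commutes with the positive real diagonal matrices (both are diagonal)
  have hδcomm : ∀ (d : Kˣ) (b : Fin 2 → ℝ≥0ˣ),
      δ d * posRealDiagonal 2 K b = posRealDiagonal 2 K b * δ d := by
    intro d b
    rw [posRealDiagonal_apply]
    change glDiagonal 2 (AdeleRing (𝓞 K) K) _ * glDiagonal 2 (AdeleRing (𝓞 K) K) _ =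
      glDiagonal 2 (AdeleRing (𝓞 K) K) _ * glDiagonal 2 (AdeleRing (𝓞 K) K) _
    rw [← map_mul, ← map_mul, mul_comm]
  -- the compact set
  haveI := t2Space_adeleRing K
  set C : Set (GL (Fin 2) (AdeleRing (𝓞 K) K)) :=
    (⋃ d ∈ {ξ : Kˣ | algebraMap K (AdeleRing (𝓞 K) K) ξ ∈ E}, (fun y => δ d * y) '' Y) ∩
      {c | ((Matrix.GeneralLinearGroup.det c : (AdeleRing (𝓞 K) K)ˣ) : AdeleRing (𝓞 K) K) = 1} with hC
  have hCc : IsCompact C :=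
    (hDfin.isCompact_biUnion fun d _ => hYc.image (continuous_const.mul continuous_id)).inter_right
      (isClosed_eq (Units.continuous_val.comp Matrix.GeneralLinearGroup.continuous_det) continuous_const)
  refine ⟨t, ht, C, hCc, fun c hc => Units.val_eq_one.1 hc.2, fun g hg => ?_⟩
  obtain ⟨γ, hγ, τ, b, hprod, hroot, y, hy, hgeq, hdetg⟩ := hdec g
  -- `τ = 1`
  have hτ : posRealScalar 2 K τ = 1 := by
    refine posRealScalar_eq_one_of_glAbsDet_eq_one K two_ne_zero ?_
    rw [glAbsDet_posRealScalar, ← hdetg]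
    refine Units.ext ?_
    change ((ideleNormUnits K (Matrix.GeneralLinearGroup.det g) : ℝ≥0ˣ) : ℝ≥0) = 1
    rw [hg, map_one, Units.val_one]
  rw [hτ, one_mul] at hgeq
  have ha : posRealDiagonal 2 K b ∈ siegelCone 2 K t := ⟨b, hprod, hroot, rfl⟩
  -- determinants: `det a = 1`, `det γ = (det y)⁻¹`
  have hdeta : Matrix.GeneralLinearGroup.det (posRealDiagonal 2 K b) = 1 := by
    have hb : ∏ i, b i = 1 := by
      refine Units.ext (NNReal.eq ?_)
      rw [Units.coe_prod, NNReal.coe_prod, Units.val_one, NNReal.coe_one]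
      exact hprod
    refine Units.ext ?_
    rw [Matrix.GeneralLinearGroup.val_det_apply, coe_posRealDiagonal, Matrix.det_diagonal, ← Units.coe_prod,
      ← map_prod, hb, map_one, Units.val_one]
  have hdetγ : Matrix.GeneralLinearGroup.det γ = (Matrix.GeneralLinearGroup.det y)⁻¹ := by
    have h := congrArg Matrix.GeneralLinearGroup.det hgeq
    rw [map_mul, map_mul, hdeta, one_mul, hg] at h
    exact eq_inv_of_mul_eq_one_left h.symm
  -- the rational correction `d := det γ₀`
  obtain ⟨γ₀, rfl⟩ := hγ
  set d : Kˣ := Matrix.GeneralLinearGroup.det γ₀ with hd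
  have hdp : Units.map (algebraMap K (AdeleRing (𝓞 K) K) : K →* AdeleRing (𝓞 K) K) d =
      Matrix.GeneralLinearGroup.det (Matrix.GeneralLinearGroup.map (algebraMap K (AdeleRing (𝓞 K) K)) γ₀) := by
    rw [Matrix.GeneralLinearGroup.map_det]
  have hdD : d ∈ {ξ : Kˣ | algebraMap K (AdeleRing (𝓞 K) K) ξ ∈ E} := by
    refine ⟨(Matrix.GeneralLinearGroup.det y)⁻¹, ⟨Matrix.GeneralLinearGroup.det y, ⟨y, hy, rfl⟩, rfl⟩, ?_⟩
    rw [← hdetγ, ← hdp]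
    rfl
  -- assemble `g = (γ δ⁻¹) · a · (δ y)`
  refine ⟨Matrix.GeneralLinearGroup.map (algebraMap K (AdeleRing (𝓞 K) K)) γ₀ * (δ d)⁻¹,
    Subgroup.mul_mem _ ⟨γ₀, rfl⟩ (Subgroup.inv_mem _ (hδ d).1), ?_, posRealDiagonal 2 K b, ha, δ d * y, ⟨?_, ?_⟩, ?_⟩
  · rw [map_mul, map_inv, (hδ d).2, hdp, mul_inv_cancel]
  · simp only [Set.mem_iUnion, Set.mem_image]
    exact ⟨d, hdD, y, hy, rfl⟩
  · show ((Matrix.GeneralLinearGroup.det (δ d * y) : (AdeleRing (𝓞 K) K)ˣ) : AdeleRing (𝓞 K) K) = 1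
    rw [map_mul, (hδ d).2, hdp, hdetγ, inv_mul_cancel, Units.val_one]
  · calc Matrix.GeneralLinearGroup.map (algebraMap K (AdeleRing (𝓞 K) K)) γ₀ * (δ d)⁻¹ * posRealDiagonal 2 K b * (δ d * y)
        = Matrix.GeneralLinearGroup.map (algebraMap K (AdeleRing (𝓞 K) K)) γ₀ * ((δ d)⁻¹ * (δ d * posRealDiagonal 2 K b)) * y := by
          rw [hδcomm]; simp only [mul_assoc]
      _ = Matrix.GeneralLinearGroup.map (algebraMap K (AdeleRing (𝓞 K) K)) γ₀ * (posRealDiagonal 2 K b * y) := by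
          rw [inv_mul_cancel_left, mul_assoc]
      _ = g := hgeq.symm

end SL2Reduction

end Literature.NumberTheory.Automorphic
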